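import Summits.QuantumFields.YangMills.Theorems.SwapVirialDeficitSectorLaplaceEndGaussShellInterface
import HarnessLib

/-!
# STUB (S-end-G♭) OF SKELETON ➎, (I2) BOOKKEEPING: the reference one-loop weight `D p = ofReal((√det AF(gnoBase p))⁻¹)` IS MEASURABLE
# (free-hands support of ⟨stmt-QuantumFields-24197⟩ `SwapVirialDeficit.SwapGluedStiffness`; cell ym-idea-1, LEAD g99 INTERFACE RULING (I2) — w3's ✓`endGauss_slab_le` takes `hDm : Measurable D`;
# assembler fcl-p3 g48)

* `measurable_det_of_measurable_form` — generic: a family `A : M → V →ₗ V` of SYMMETRIC operators on a finite-dimensional real inner product space whose quadratic form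
  `(η, y) ↦ ⟪A η y, y⟫` is jointly measurable has a measurable determinant `η ↦ det A η` (polarisation in an orthonormal basis, `det` continuous);
* ★ `measurable_D_ref` — for the reference family of (I1) (conjunct 6 of ✓`exists_gnoFolHessian` = `hAm`): `Measurable fun p => ofReal((√det AF(gnoBase p.1 p.2))⁻¹)`.

HONEST LABEL: measurability bookkeeping; `stub_end_gaussCore`, `stub_core_tip`, ⟨24197⟩ ∕ ⟨24194⟩ OPEN; item of record ⟨24085⟩ aside ∕ untouched; the Yang–Mills mass gap is NOT proved;
no summit is proved by a line.  THEOREMS ONLY (0 `def`, 0 `sorry`), standard axioms, no instances.  Seat ym-line-fcl-p3 g48, `--supports stmt-QuantumFields-24197`.  References: [folklore].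
-/

set_option autoImplicit false
set_option synthInstance.maxSize 1024

noncomputable section

open MeasureTheory Quaternion Set Module Metric
open scoped Quaternion BigOperators ENNReal InnerProductSpace
open Literature.MathematicalPhysics.QuantumLattice
open Literature.MathematicalPhysics.QuantumFieldTheory hiding SU2

namespace Summit.QuantumFields.YangMills.Theorems.SwapVirialDeficit.SectorLaplace

open Summit.QuantumFields.YangMills.Theorems.FemtoTransferGap
open Summit.QuantumFields.YangMills.Theorems.FemtoTransferGap.TT
open Summit.QuantumFields.YangMills.Theorems.VirialFluxGap.RingDeficit
open Summit.QuantumFields.YangMills.Theorems.SwapVirialDeficit.SwapRing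
open Summit.QuantumFields.YangMills.Theorems.SwapVirialDeficit.BlowUpRing

variable {L : ℕ} [NeZero L]

omit [NeZero L] in
/-- A family of SYMMETRIC operators with jointly measurable quadratic form has a measurable determinant (polarisation in an orthonormal basis; `det` is continuous). [folklore] -/
theorem measurable_det_of_measurable_form {M V : Type*} [MeasurableSpace M] [NormedAddCommGroup V] [InnerProductSpace ℝ V] [FiniteDimensional ℝ V]
    [MeasurableSpace V] [BorelSpace V]
    {A : M → V →ₗ[ℝ] V} (hAs : ∀ η, (A η).IsSymmetric) (hAm : Measurable fun q : M × V => ⟪A q.1 q.2, q.2⟫_ℝ) :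
    Measurable fun η => LinearMap.det (A η) := by
  classical
  set b := stdOrthonormalBasis ℝ V with hb
  -- entries by polarisation
  have hform : ∀ v : V, Measurable fun η : M => ⟪A η v, v⟫_ℝ := fun v => hAm.comp (measurable_id.prodMk measurable_const)
  have hentry : ∀ i j, Measurable fun η : M => ⟪b i, A η (b j)⟫_ℝ := by
    intro i j
    have e : ∀ η, ⟪b i, A η (b j)⟫_ℝ = (⟪A η (b i + b j), b i + b j⟫_ℝ - ⟪A η (b i - b j), b i - b j⟫_ℝ) / 4 := by
      intro η
      have h1 : ⟪A η (b i), b j⟫_ℝ = ⟪b i, A η (b j)⟫_ℝ := hAs η _ _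
      have h2 : ⟪A η (b j), b i⟫_ℝ = ⟪b i, A η (b j)⟫_ℝ := real_inner_comm (b i) (A η (b j))
      rw [map_add, map_sub]
      simp only [inner_add_left, inner_add_right, inner_sub_left, inner_sub_right]
      linarith
    simp_rw [e]
    exact ((hform _).sub (hform _)).div_const 4
  -- the matrix of `A η` in the basis `b`, as a plain function (the `Matrix` synonym carries no measurable structure)
  set Mx : M → (Fin (finrank ℝ V) → Fin (finrank ℝ V) → ℝ) := fun η i j => ⟪b i, A η (b j)⟫_ℝ with hMx
  have hMxm : Measurable Mx := measurable_pi_lambda _ fun i => measurable_pi_lambda _ fun j => hentry i j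
  have hdet : Continuous fun X : Fin (finrank ℝ V) → Fin (finrank ℝ V) → ℝ => (Matrix.of X).det :=
    Continuous.matrix_det continuous_id
  have e : (fun η => LinearMap.det (A η)) = (fun X : Fin (finrank ℝ V) → Fin (finrank ℝ V) → ℝ => (Matrix.of X).det) ∘ Mx := by
    funext η
    simp only [Function.comp_apply]
    rw [← LinearMap.det_toMatrix b.toBasis (A η)]
    congr 1
    ext i j
    rw [LinearMap.toMatrix_apply, OrthonormalBasis.coe_toBasis, OrthonormalBasis.coe_toBasis_repr_apply, OrthonormalBasis.repr_apply_apply, Matrix.of_apply]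
  rw [e]
  exact hdet.measurable.comp hMxm

/-- ★ **(I2)'s WEIGHT IS MEASURABLE**: for any follower-Hessian family with symmetric operators and jointly measurable form (conjuncts 1 and 6 of ✓`exists_gnoFolHessian`),
`p ↦ ofReal((√det AF(gnoBase p))⁻¹)` is measurable on the base plane. [folklore] -/
theorem measurable_D_ref {AF : GnoCoord L → GnoFol L →ₗ[ℝ] GnoFol L} (hFs : ∀ η, (AF η).IsSymmetric)
    (hAm : Measurable fun q : GnoCoord L × GnoFol L => ⟪AF q.1 q.2, q.2⟫_ℝ) :
    Measurable fun p : ℝ × ℝ => ENNReal.ofReal ((Real.sqrt (LinearMap.det (AF (gnoBase p.1 p.2))))⁻¹) := by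
  have hb : Measurable fun p : ℝ × ℝ => (gnoBase p.1 p.2 : GnoCoord L) := by
    have h := (continuous_gnoBase (L := L)).measurable
    exact h
  have hdet := (measurable_det_of_measurable_form hFs hAm).comp hb
  exact ENNReal.measurable_ofReal.comp ((Real.continuous_sqrt.measurable.comp hdet).inv)

end Summit.QuantumFields.YangMills.Theorems.SwapVirialDeficit.SectorLaplace

end
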